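import Mathlib
import HarnessLib

/-!
# The frame's quotient is the shadow's local ring (`stub_frameQuotientEquiv`)

Stub of the birth line of the crux `ShadowsUniformize` (route `AbhyankarShadows`).

Setting: `k ⊆ K` fields, `O` a valuation subring of `K`, `A ⊆ O` a `k`-subalgebra of `K`,
`𝔭 = 𝔪_O ∩ A` the centre of `O` on `A`, `B = A_𝔭`; a shadow map `ψ : A →ₐ[k] L` into a field `L`
with `ψ(A) ⊆ O'` for a valuation subring `O'` of `L` having the SAME centre
(`O'.v (ψ a) < 1 ↔ O.v a < 1`); `𝔭' = 𝔪_{O'} ∩ ψ(A)`, `D = ψ(A)_{𝔭'}`, `Q = (ker ψ) B`.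

Claim: `Q` is prime and `B ⧸ Q ≃+* D`.

Proof: the corestriction `φ : A → ψ(A)` of `ψ` is surjective and, by the same-centre clause,
`φ⁻¹(𝔭') = 𝔭`, hence `φ(A ∖ 𝔭) = ψ(A) ∖ 𝔭'` as submonoids. Localization is functorial:
the induced map `B = A_𝔭 → D` is surjective (`IsLocalization.map_surjective_of_surjective`) with
kernel `(ker φ) B = (ker ψ) B = Q` (`IsLocalization.ker_map`, localization commutes with kernels).
So `B ⧸ Q ≃+* D` (`RingHom.quotientKerEquivOfSurjective`), and `Q` is prime because `D`, a
localization of the domain `ψ(A) ⊆ L`, is a domain (`RingHom.ker_isPrime`).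
-/

-- single-problem summit: the doubled namespace component is forced
set_option linter.dupNamespace false

namespace Summit.ResolutionOfSingularities.ResolutionOfSingularities.Theorems

/-- Localization along a surjection `g : R → C` carrying the submonoid `M` onto `T`:
the induced map `M⁻¹R → T⁻¹C` is surjective with kernel `(ker g) M⁻¹R`, so if `T⁻¹C` is a domain
then `(ker g) M⁻¹R` is prime and `M⁻¹R ⧸ (ker g) M⁻¹R ≃+* T⁻¹C`. [folklore] -/
theorem frameQuotient_isPrime_and_quotientEquiv_of_surjective
    {R S C D : Type*} [CommRing R] [CommRing S] [CommRing C] [CommRing D]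
    [Algebra R S] [Algebra C D] {M : Submonoid R} {T : Submonoid C}
    [IsLocalization M S] [IsLocalization T D] [IsDomain D]
    (g : R →+* C) (hg : Function.Surjective g) (hT : M.map g = T) :
    ((RingHom.ker g).map (algebraMap R S)).IsPrime ∧
      Nonempty (S ⧸ (RingHom.ker g).map (algebraMap R S) ≃+* D) := by
  subst hT
  have hsurj := IsLocalization.map_surjective_of_surjective M S D hg
  have hker := IsLocalization.ker_map (S := S) D g (rfl : M.map g = M.map g)
  refine ⟨?_, ⟨(Ideal.quotEquivOfEq hker.symm).trans
    (RingHom.quotientKerEquivOfSurjective hsurj)⟩⟩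
  rw [← hker]
  exact RingHom.ker_isPrime _

/-- **The frame's quotient is the shadow's local ring.** With `𝔭 = 𝔪_O ∩ A`, `B = A_𝔭`,
`Q = (ker ψ) B`, `D = ψ(A)_{𝔪_{O'} ∩ ψ(A)}`: the same-centre clause gives that the corestriction
`A → ψ(A)` of `ψ` pulls `𝔪_{O'} ∩ ψ(A)` back to `𝔭`, so `ψ` extends to a surjection `B → D`
with kernel `Q`; hence `Q` is prime and `B ⧸ Q ≃+* D`. [folklore] -/
theorem stub_frameQuotientEquiv (k K L : Type) [Field k] [Field K] [Algebra k K] [Field L]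
    [Algebra k L] (O : ValuationSubring K) (A : Subalgebra k K) (h : A.toSubring ≤ O.toSubring)
    (ψ : A →ₐ[k] L) (O' : ValuationSubring L) (hψ : ψ.range.toSubring ≤ O'.toSubring)
    (hcentre : ∀ a : A, O'.valuation (ψ a) < 1 ↔ O.valuation (a : K) < 1) :
    (Ideal.map (algebraMap A.toSubring (Localization.AtPrime
        (Ideal.comap (Subring.inclusion h) (IsLocalRing.maximalIdeal O)))) (RingHom.ker ψ)).IsPrime ∧
    Nonempty ((Localization.AtPrime (Ideal.comap (Subring.inclusion h) (IsLocalRing.maximalIdeal O)) ⧸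
        Ideal.map (algebraMap A.toSubring (Localization.AtPrime
          (Ideal.comap (Subring.inclusion h) (IsLocalRing.maximalIdeal O)))) (RingHom.ker ψ)) ≃+*
      Localization.AtPrime (Ideal.comap (Subring.inclusion hψ) (IsLocalRing.maximalIdeal O'))) := by
  -- the corestriction of `ψ`, on the carriers of the two subrings
  obtain ⟨φ, hφ⟩ : ∃ φ : A.toSubring →+* ψ.range.toSubring, ∀ a, (φ a : L) = ψ a :=
    ⟨ψ.rangeRestrict.toRingHom, fun _ => rfl⟩
  -- membership in the two centres is `valuation < 1`
  have hP : ∀ r : A.toSubring,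
      r ∈ Ideal.comap (Subring.inclusion h) (IsLocalRing.maximalIdeal O) ↔
        O.valuation (r : K) < 1 :=
    fun r => Ideal.mem_comap.trans (O.valuation_lt_one_iff ⟨r, h r.2⟩)
  have hP' : ∀ c : ψ.range.toSubring,
      c ∈ Ideal.comap (Subring.inclusion hψ) (IsLocalRing.maximalIdeal O') ↔
        O'.valuation (c : L) < 1 :=
    fun c => Ideal.mem_comap.trans (O'.valuation_lt_one_iff ⟨c, hψ c.2⟩)
  -- same centre: `φ⁻¹(𝔭') = 𝔭`
  have hφP : ∀ r : A.toSubring,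
      φ r ∈ Ideal.comap (Subring.inclusion hψ) (IsLocalRing.maximalIdeal O') ↔
        r ∈ Ideal.comap (Subring.inclusion h) (IsLocalRing.maximalIdeal O) := fun r => by
    rw [hP, hP', hφ]
    exact hcentre r
  have hφsurj : Function.Surjective φ := by
    rintro ⟨c, hc⟩
    obtain ⟨a, ha⟩ := (AlgHom.mem_range ψ).1 hc
    exact ⟨a, Subtype.ext ((hφ a).trans ha)⟩
  have hkerφ : RingHom.ker φ = (RingHom.ker ψ : Ideal A.toSubring) := by
    ext a
    rw [RingHom.mem_ker, RingHom.mem_ker, ← ZeroMemClass.coe_eq_zero, hφ]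
  have hT : (Ideal.comap (Subring.inclusion h) (IsLocalRing.maximalIdeal O)).primeCompl.map φ =
      (Ideal.comap (Subring.inclusion hψ) (IsLocalRing.maximalIdeal O')).primeCompl := by
    ext c
    simp only [Submonoid.mem_map, Ideal.mem_primeCompl_iff]
    constructor
    · rintro ⟨r, hr, rfl⟩
      exact fun hc => hr ((hφP r).1 hc)
    · intro hc
      obtain ⟨r, rfl⟩ := hφsurj c
      exact ⟨r, fun hr => hc ((hφP r).2 hr), rfl⟩
  rw [← hkerφ]
  exact frameQuotient_isPrime_and_quotientEquiv_of_surjective φ hφsurj hT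

end Summit.ResolutionOfSingularities.ResolutionOfSingularities.Theorems
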